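import Literature.MathematicalPhysics.QuantumFieldTheory.BalabanImbrieJaffe1984to88.BIJ88RT51GeneralStep

/-!
# `BalabanImbrieJaffe1984to88.BIJ88RT51Unique` — T. Bałaban, J. Imbrie, A. Jaffe, *Effective action and cluster properties of the
abelian Higgs model*, Commun. Math. Phys. **114** (1988) 257–315 [BalabanImbrieJaffe1988], Sect. 5.1 p. 277 [PDF 21]: the renormalization
transformation **(5.1.1)** of the general step DETERMINES the density `ρ̃^L_{k+1}(v, ψ)` `dv dψ`-almost everywhere, and sees it only
through `dv dψ`-integrals — the well-definedness of the typed push-forward reading `IsRT511`/`IsRT511Ax` of file 1 `BIJ88RT51GeneralStep`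
(file 4 of seat p34 gen 5; the one-step analogues are r18's `BIJ88BlockGauge417.isRT311_unique` and p34 gen 4's
`BIJ88GaugeAverage.isRT311_congr_ae`).

statement-level skeleton of published theorems with citation tags; proofs where landed; nothing here is a claim about the Yang–Mills mass gap

PDF held: `paper:balaban1988-cmp114-bij-abelian-higgs-effective-action` (journal page = PDF page + 256); p. 277 [PDF 21] read as an image
(r16's render `HOME/lit-balaban-r16/renders/cmp114/original-p021-x2.png`).

CITATION HEADER (lean-in-tree rule).  Part of the lit-balaban TYPED SKELETON (HOME `run/shared/lean/pub/lit-balaban/`), PHASE-2 proof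
seat p34 gen 5 (unit `lit-balaban-p34-g5`; free-target protocol G.5-34(d), own lineage = the C1/C2 renormalization-transformation line).
Row served (support): `C2.Eq5.1.1-5.1.4` of `HOME/lit-balaban-r16/ROWS-C2-part2.md` (fold owner r16).

THE PRINTED TEXT (p. 277 [PDF 21], verbatim).  *"A density of ρ̃^L_{k+1}(v, ψ) is obtained by applying the renormalization
transformations of [1] to ρ′_k as follows: ρ̃^L_{k+1}(v, ψ) = Σ_{{X_ω}} T_L[…] ≡ Σ_{{X_ω}} ∫𝒟u δ(v/Qu) ∫ Π_{j=0}^{k−1} 𝒟u^{(j)}_{Λ^{(j)c*}_{10}} ∫𝒟φ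
exp[−½aL⁻²⟨ψ − Q(u_k)φ, ψ − Q(u_k)φ⟩ − E^{(k)}] ρ′_k(u, φ, {X_ω}, {u^{(j)}}). (5.1.1)"* — "a density": in the tree's push-forward reading
of the `δ`-function `δ(v/Qu)` (file 1), (5.1.1) characterises `ρ̃^L_{k+1}` as a `dv dψ`-density, i.e. up to `dv dψ`-null sets.

WHAT IS PROVED (theorems only; carriers of file 1: levels `k`, `k + 1` of `Balaban1983to89.Setup`, `𝒟u` = `fieldMeasure`, `dψ` = Lebesgue,
`IsRT511 terms Qu Qφ a ρ′ ρ̃` / `IsRT511Ax`).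
* `ae_eq_of_forall_test`: two `dv dψ`-integrable functions with the same integrals against every bounded measurable test function agree
  almost everywhere (indicators + Fubini; the argument of r18's `isRT311_unique`).
* **`isRT511_unique`**, **`isRT511Ax_unique`**: two `dv dψ`-integrable densities satisfying (5.1.1) (resp. (5.1.1) with (5.1.4)) for the
  SAME data `terms`, `Qu`, `Q_t`, `a`, `ρ′_t` agree `dv dψ`-almost everywhere — (5.1.1) determines `ρ̃^L_{k+1}` up to null sets, for ANY data.
* **`isRT511_congr_ae`**, **`isRT511Ax_congr_ae`**: conversely a `dv dψ`-integrable function almost everywhere equal to a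
  `dv dψ`-integrable solution of (5.1.1) is a solution — (5.1.1) sees `ρ̃` only through `dv dψ`-integrals (so an exactly gauge-invariant
  VERSION may be chosen, as p34 gen 4's `BIJ88GaugeAverage.gaugeAvg` does for one step).
NOT DONE HERE (honest scope): existence of a solution (Radon–Nikodym; history-free: p34 gen 2's `BIJ88RT311Exists.isRT311_rt` via file 2's
`isRT311_iff_isRT511_single`); no bound.  Re-declares nothing; imports file 1; no `Prop`-valued fact; standard axioms.
-/

namespace Literature.MathematicalPhysics.QuantumFieldTheory.BalabanImbrieJaffe1984to88.BIJ88RT51Unique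

open Literature.MathematicalPhysics.QuantumFieldTheory.Balaban1983to89
open BIJ88Sect3Statements (U1)
open BIJ85Sect1Model (HiggsField)
open BIJ88InductiveForm41 (Prev prevMeasure)
open BIJ88RT51GeneralStep (IsRT511 IsRT511Ax)
open scoped BigOperators ENNReal
open _root_.MeasureTheory _root_.MeasureTheory.Measure Complex Function

noncomputable section

variable {P : Params} {k : ℕ}

/-- kernel: testing an integrable density against the indicator of a measurable set computes its set integral (Fubini).
[cite: BalabanImbrieJaffe1988, (5.1.1) p.277] -/
theorem setIntegral_eq_integral_mul_indicator {ρ : GaugeField P (k+1) U1 → HiggsField P (k+1) → ℂ}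
    (hρ : Integrable (uncurry ρ) ((fieldMeasure P (k+1) U1).prod volume))
    {S : Set (GaugeField P (k+1) U1 × HiggsField P (k+1))} (hS : MeasurableSet S) :
    ∫ z in S, uncurry ρ z ∂(fieldMeasure P (k+1) U1).prod volume =
      ∫ v, ∫ ψ, ρ v ψ * S.indicator (fun _ => (1 : ℂ)) (v, ψ) ∂volume ∂fieldMeasure P (k+1) U1 := by
  rw [← integral_indicator hS, integral_prod _ (hρ.indicator hS)]
  refine integral_congr_ae (ae_of_all _ fun v => integral_congr_ae (ae_of_all _ fun ψ => ?_))
  by_cases hz : (v, ψ) ∈ S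
  · simp [Set.indicator_of_mem hz]
  · simp [Set.indicator_of_notMem hz]

/-- kernel: **two `dv dψ`-integrable functions with the same integrals against every bounded measurable test function agree almost
everywhere** (test against indicators of measurable sets). [cite: BalabanImbrieJaffe1988, (5.1.1) p.277] -/
theorem ae_eq_of_forall_test {ρ ρ' : GaugeField P (k+1) U1 → HiggsField P (k+1) → ℂ}
    (hi : Integrable (uncurry ρ) ((fieldMeasure P (k+1) U1).prod volume))
    (hi' : Integrable (uncurry ρ') ((fieldMeasure P (k+1) U1).prod volume))
    (h : ∀ g : GaugeField P (k+1) U1 × HiggsField P (k+1) → ℂ, Measurable g → (∃ C : ℝ, ∀ z, ‖g z‖ ≤ C) →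
      ∫ v, ∫ ψ, ρ v ψ * g (v, ψ) ∂volume ∂fieldMeasure P (k+1) U1 = ∫ v, ∫ ψ, ρ' v ψ * g (v, ψ) ∂volume ∂fieldMeasure P (k+1) U1) :
    uncurry ρ =ᵐ[(fieldMeasure P (k+1) U1).prod volume] uncurry ρ' := by
  refine hi.ae_eq_of_forall_setIntegral_eq _ _ hi' fun S hS _ => ?_
  have ht : Measurable (S.indicator fun _ => (1 : ℂ)) := measurable_const.indicator hS
  have hb : ∃ C : ℝ, ∀ z, ‖S.indicator (fun _ => (1 : ℂ)) z‖ ≤ C :=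
    ⟨1, fun z => by by_cases hz : z ∈ S <;> simp [hz]⟩
  rw [setIntegral_eq_integral_mul_indicator hi hS, setIntegral_eq_integral_mul_indicator hi' hS, h _ ht hb]

/-- kernel: conversely, `dv dψ`-integrable functions that agree almost everywhere have the same integrals against every bounded
measurable test function. [cite: BalabanImbrieJaffe1988, (5.1.1) p.277] -/
theorem integral_test_congr_ae {ρ ρ' : GaugeField P (k+1) U1 → HiggsField P (k+1) → ℂ}
    (hi : Integrable (uncurry ρ) ((fieldMeasure P (k+1) U1).prod volume))
    (hi' : Integrable (uncurry ρ') ((fieldMeasure P (k+1) U1).prod volume))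
    (hae : uncurry ρ' =ᵐ[(fieldMeasure P (k+1) U1).prod volume] uncurry ρ)
    {g : GaugeField P (k+1) U1 × HiggsField P (k+1) → ℂ} (hg : Measurable g) (hb : ∃ C : ℝ, ∀ z, ‖g z‖ ≤ C) :
    ∫ v, ∫ ψ, ρ' v ψ * g (v, ψ) ∂volume ∂fieldMeasure P (k+1) U1 = ∫ v, ∫ ψ, ρ v ψ * g (v, ψ) ∂volume ∂fieldMeasure P (k+1) U1 := by
  obtain ⟨C, hC⟩ := hb
  have key : ∀ {ρ : GaugeField P (k+1) U1 → HiggsField P (k+1) → ℂ},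
      Integrable (uncurry ρ) ((fieldMeasure P (k+1) U1).prod volume) →
      ∫ v, ∫ ψ, ρ v ψ * g (v, ψ) ∂volume ∂fieldMeasure P (k+1) U1 =
        ∫ z, uncurry ρ z * g z ∂(fieldMeasure P (k+1) U1).prod volume := by
    intro ρ hρ
    have hρt : Integrable (fun z => uncurry ρ z * g z) ((fieldMeasure P (k+1) U1).prod volume) :=
      hρ.mul_bdd hg.aestronglyMeasurable (Filter.Eventually.of_forall hC)
    exact (integral_prod _ hρt).symm
  have hae' : (fun z => uncurry ρ' z * g z) =ᵐ[(fieldMeasure P (k+1) U1).prod volume] fun z => uncurry ρ z * g z := by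
    filter_upwards [hae] with z hz
    rw [hz]
  rw [key hi', integral_congr_ae hae', ← key hi]

/-- **(5.1.1) determines `ρ̃^L_{k+1}` `dv dψ`-almost everywhere**: two `dv dψ`-integrable densities satisfying the typed (5.1.1) for the
same data (large-field terms, block averages, background kernels, Gaussian parameter, term densities — ANY data) agree almost
everywhere. [cite: BalabanImbrieJaffe1988, (5.1.1) p.277] -/
theorem isRT511_unique {ι : Type*} {terms : Finset ι} {Qu : GaugeField P k U1 → GaugeField P (k+1) U1}
    {Qφ : ι → Prev P k → GaugeField P k U1 → HiggsField P k → HiggsField P (k+1)} {a : ℝ}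
    {ρ' : ι → Prev P k → GaugeField P k U1 → HiggsField P k → ℂ} {ρL ρL' : GaugeField P (k+1) U1 → HiggsField P (k+1) → ℂ}
    (h : IsRT511 terms Qu Qφ a ρ' ρL) (h' : IsRT511 terms Qu Qφ a ρ' ρL')
    (hi : Integrable (uncurry ρL) ((fieldMeasure P (k+1) U1).prod volume))
    (hi' : Integrable (uncurry ρL') ((fieldMeasure P (k+1) U1).prod volume)) :
    uncurry ρL =ᵐ[(fieldMeasure P (k+1) U1).prod volume] uncurry ρL' :=
  ae_eq_of_forall_test hi hi' fun g hg hb => by rw [h g hg hb, h' g hg hb]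

/-- The same for (5.1.1) with the axial gauge conditions (5.1.4) inserted. [cite: BalabanImbrieJaffe1988, (5.1.4) p.278] -/
theorem isRT511Ax_unique {ι : Type*} {terms : Finset ι} {Qu : GaugeField P k U1 → GaugeField P (k+1) U1}
    {Qφ : ι → Prev P k → GaugeField P k U1 → HiggsField P k → HiggsField P (k+1)} {a : ℝ}
    {ρ' : ι → Prev P k → GaugeField P k U1 → HiggsField P k → ℂ} {ρL ρL' : GaugeField P (k+1) U1 → HiggsField P (k+1) → ℂ}
    (h : IsRT511Ax terms Qu Qφ a ρ' ρL) (h' : IsRT511Ax terms Qu Qφ a ρ' ρL')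
    (hi : Integrable (uncurry ρL) ((fieldMeasure P (k+1) U1).prod volume))
    (hi' : Integrable (uncurry ρL') ((fieldMeasure P (k+1) U1).prod volume)) :
    uncurry ρL =ᵐ[(fieldMeasure P (k+1) U1).prod volume] uncurry ρL' :=
  ae_eq_of_forall_test hi hi' fun g hg hb => by rw [h g hg hb, h' g hg hb]

/-- **(5.1.1) sees `ρ̃^L_{k+1}` only through `dv dψ`-integrals**: a `dv dψ`-integrable function almost everywhere equal to a
`dv dψ`-integrable solution of (5.1.1) is again a solution (so one may pass to any convenient version, e.g. an exactly gauge-invariant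
one). [cite: BalabanImbrieJaffe1988, (5.1.1) p.277] -/
theorem isRT511_congr_ae {ι : Type*} {terms : Finset ι} {Qu : GaugeField P k U1 → GaugeField P (k+1) U1}
    {Qφ : ι → Prev P k → GaugeField P k U1 → HiggsField P k → HiggsField P (k+1)} {a : ℝ}
    {ρ' : ι → Prev P k → GaugeField P k U1 → HiggsField P k → ℂ} {ρL ρL' : GaugeField P (k+1) U1 → HiggsField P (k+1) → ℂ}
    (h : IsRT511 terms Qu Qφ a ρ' ρL)
    (hi : Integrable (uncurry ρL) ((fieldMeasure P (k+1) U1).prod volume))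
    (hi' : Integrable (uncurry ρL') ((fieldMeasure P (k+1) U1).prod volume))
    (hae : uncurry ρL' =ᵐ[(fieldMeasure P (k+1) U1).prod volume] uncurry ρL) :
    IsRT511 terms Qu Qφ a ρ' ρL' := fun g hg hb => by
  rw [integral_test_congr_ae hi hi' hae hg hb]
  exact h g hg hb

/-- The same for (5.1.1) with the axial gauge conditions (5.1.4) inserted. [cite: BalabanImbrieJaffe1988, (5.1.4) p.278] -/
theorem isRT511Ax_congr_ae {ι : Type*} {terms : Finset ι} {Qu : GaugeField P k U1 → GaugeField P (k+1) U1}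
    {Qφ : ι → Prev P k → GaugeField P k U1 → HiggsField P k → HiggsField P (k+1)} {a : ℝ}
    {ρ' : ι → Prev P k → GaugeField P k U1 → HiggsField P k → ℂ} {ρL ρL' : GaugeField P (k+1) U1 → HiggsField P (k+1) → ℂ}
    (h : IsRT511Ax terms Qu Qφ a ρ' ρL)
    (hi : Integrable (uncurry ρL) ((fieldMeasure P (k+1) U1).prod volume))
    (hi' : Integrable (uncurry ρL') ((fieldMeasure P (k+1) U1).prod volume))
    (hae : uncurry ρL' =ᵐ[(fieldMeasure P (k+1) U1).prod volume] uncurry ρL) :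
    IsRT511Ax terms Qu Qφ a ρ' ρL' := fun g hg hb => by
  rw [integral_test_congr_ae hi hi' hae hg hb]
  exact h g hg hb

end

end Literature.MathematicalPhysics.QuantumFieldTheory.BalabanImbrieJaffe1984to88.BIJ88RT51Unique
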